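import Summits.QuantumFields.YangMills.Theorems.BalabanUVNodesN07LaplaceAOfRecordFlatPos
import Summits.QuantumFields.YangMills.Theorems.BalabanUVNodesN07QOfRecordGaugeCovariance
import Literature.MathematicalPhysics.QuantumFieldTheory.Balaban1983to89.B9Eq330HessianCovariance
import Literature.MathematicalPhysics.QuantumFieldTheory.Balaban1983to89.B5Eq172FlatFibreNaturality
import Literature.MathematicalPhysics.QuantumFieldTheory.Balaban1983to89.T3DescentFibreTower
import HarnessLib

/-!
# NODE N07 — [B9] (3.34) `Δ_a(U^u) = R(u)Δ_a(U)R(u⁻¹)` FOR def-Y's PINNED `Δ_{1,a}(U₀)` OF RECORD (Q := QOfRecord F N k U₀, Q′♭ := QflatOfRecord F N k), AND THE TRANSFER OF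
# `hpos` ALONG GAUGE ORBITS: `Δ_{1,a}` IS POSITIVE DEFINITE AT EVERY PURE-GAUGE BACKGROUND `1^u`

Cell `pub-ymgap`, width seat `pub-ymgap-dag-n07-w3` (g24), CLAIM-5.  `--kind proof --supports stmt-QuantumFields-27238 --as helper`; count-neutral.
[B9] = [Balaban1985BackgroundPropagators]; [B5] = [Balaban1984PropagatorsI]; [15] = [Balaban1985Variational].

WHY.  [B9] p.396: the covariance of every letter ((3.30) Hessian, (3.31) covariant derivative∕Laplacian, (3.32) averaging operators, (3.33) the projection `R(U)`) gives
`Δ_a(U^u) = R(u)Δ_a(U)R(u⁻¹)` (3.34) and hence [B9] Thm 3.11's positivity is a property of the GAUGE ORBIT («All these inequalities are invariant with respect to gauge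
transformations of U», p.398) — the algebraic half of print's passage from small fields to the regularity class (3.35).  Lit has every letter's covariance generically
(✓`B9Eq328GaugeAction`, ✓`B9Eq330HessianCovariance.hessOp_gaugeU`, ✓`B5Eq172FlatFibreNaturality.map_projR_of_intertwine`, ✓`B9Eq334LaplaceACovariance.adjoint_intertwine`) and
this seat's ✓p816707 supplies (3.32) for the pinned (0.4)-linearised `Q`; here: the transporter dictionary of the record under gauge, the covariance of `Q′♭`'s kernel and of the
projection, the assembly (3.34), and the transfer of `hpos` — in particular from ✓p816354 (`U₀ = 1`) to every pure gauge `1^u`.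

WHAT IS PROVED (sorry-free; no definition; axioms standard).
* §1 `suToUnits_mul` ∕ `suToUnits_inv`, ★ `unitsOfRecord_gaugeAct` (`unitsOfRecord (u • U₀) = gaugeU g (unitsOfRecord U₀)`, `g` = `u` read on lit's sites), `smallBelow_one` (the flat background
  is on 35b's guard, every level).
* §2 ★ `hessOpOfRecord_gaugeAct` ((3.30) at the record), `QflatOfRecord_gaugeW` ∕ `QflatOfRecord_gaugeW_eq_zero_iff` (Q′♭ intertwines `R(u)` and `R(ū)`), ★ `RrOfRecord_gaugeAct` ((3.33b) at the record).
* §3 `covDerivL2K_RRec_gaugeAct` ∕ `covDivL2K_SRec_gaugeAct` ((3.31) at the record), `QOfRecord_gaugeAct_bpos` ((3.32), ✓p816707, lit's bond-source spelling), `adjoint_QOfRecord_gaugeAct` (the `Q*`-slot),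
  ★★ `laplaceAOfRecord_gaugeAct` — (3.34): `Δ_{1,a}(u • U₀) (R(u)f) = R(u) (Δ_{1,a}(U₀) f)` for `U₀` on the (35b) guard up to level `k ≤ m + K`; ★★ `inner_laplaceAOfRecord_gaugeAct` (the form is gauge invariant).
* §4 ★★★ `laplaceAOfRecord_pos_gaugeAct` (`hpos(U₀) ⟹ hpos(u • U₀)`), `laplaceAOfRecord_pos_of_pos_gaugeAct` (converse), `laplaceAOfRecord_pos_gaugeAct_iff`, and ★★★ `laplaceAOfRecord_pureGauge_pos` —
  `0 < re⟪x, laplaceAOfRecord F N k (u • 1) (QOfRecord F N k (u • 1)) (QflatOfRecord F N k) a x⟫` for `x ≠ 0`, `a > 0`, `k ≤ m + K`, EVERY gauge transformation `u`: def-Y's displayed `hpos` of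
  `frakGOfRecordAtBgFlat` holds on the whole gauge orbit of the flat background (19 theorems).

HONEST SCOPE.  Pure gauges only beyond `U₀ = 1` (curvature zero); the small-field statement of [B9] Thm 3.11 ((3.35) regularity gauge + (3.86) perturbation ∕ `G_□` localisation) is
NOT here; positivity only, no constant; `Q′`-slot = the flat site letter `QflatOfRecord` of ROAD (ii) only — print's (3.18) block-mean slot `QprimeOfRecord` of `frakGOfRecordAtBg` is NOT covered; nothing of [B5]∕[B9]∕[15] asserted; P0 OPEN; N07 NOT discharged; K0ᴬ∕K1ᴬ∕K3ᴬ OPEN; counts unmoved (28∕28 · 8∕28 · K 1∕4); one finite 𝕋⁴ programme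
at fixed ε — R4 closes the conditional finite-𝕋⁴ rung `BalabanLadder.UV` only, never the summit; nothing continuum ∕ ℝ⁴ ∕ OS; the Yang–Mills mass gap (Clay) is NOT proved by any of this.
No `sorry`, no `def`, no `instance`, no `notation`.

References: [B9] (3.28)–(3.34) pp.395–396, (3.21)–(3.26) pp.394–395, Thm 3.11 p.416, p.398; [B5] (1.69)–(1.72) pp.29–30; [15] (110)–(111) p.294, (116)–(117) p.295.
-/

set_option autoImplicit false

noncomputable section

open scoped InnerProductSpace ComplexConjugate Matrix

namespace Summit.QuantumFields.YangMills.Theorems.N07LaplaceAOfRecordGaugeOrbitPos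

open Literature.MathematicalPhysics.QuantumFieldTheory.Balaban1983to89
open Literature.MathematicalPhysics.QuantumFieldTheory.Balaban1983to89.T4Continuum (T4Family)
open T4Continuum BlockAveraging
open ExpMeanLog (expMeanLogSU)
open B4Sect5Torus (TSite)
open B9SectCLatticeCarrier (Bond bpos btgt)
open B9Eq311L2Pairing (WL2)
open B9Eq310HessianOperator (adTransportW hessOp)
open B11Eq103H1Complex (SiteL2K BondL2K covDerivL2K covDivL2K covLaplaceSiteK RLatticeK projR laplaceALatticeK laplaceAK_apply adjoint_covDerivL2K)
open B9Eq328GaugeAction (gaugeU gaugeU_apply gaugeW AdW AdA equiv_gaugeW_eq AdW_apply gaugeW_inv_apply gaugeW_apply_inv inner_gaugeW inner_gaugeW_left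
  inner_AdW_AdW_of_compat tau_AdA_of_trace gaugeW_eq_zero_iff covDerivL2K_gaugeU covDivL2K_gaugeU covLaplaceSiteK_gaugeU)
open B9Eq330HessianCovariance (hessOp_gaugeU)
open B5Eq172FlatFibreNaturality (map_projR_of_intertwine)
open B16Sect1Backgrounds (toMS)
open Node00
open Summit.QuantumFields.YangMills.Theorems.N07QOfRecordGaugeCovariance (QOfRecord_gaugeAct)
open Summit.QuantumFields.YangMills.Theorems.N07LaplaceAOfRecordFlatPos (laplaceAOfRecord_one_flat_pos)
open GaugeField (gaugeAct)

variable (F : T4Family) (N : ℕ) [NeZero N] {K : ℕ} (k : ℕ)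

/-! ## §1  The record's transporter datum under a gauge transformation; the flat background is on the guard -/

omit [NeZero N] in
/-- `suToUnits` is multiplicative. [folklore] -/
theorem suToUnits_mul (x y : SU N) : suToUnits N (x * y) = suToUnits N x * suToUnits N y := Units.ext rfl

omit [NeZero N] in
/-- `suToUnits` commutes with inversion. [folklore] -/
theorem suToUnits_inv (x : SU N) : suToUnits N x⁻¹ = (suToUnits N x)⁻¹ := Units.ext rfl

/-- ★ **THE RECORD's TRANSPORTERS UNDER A GAUGE TRANSFORMATION ARE lit's `gaugeU`**: `unitsOfRecord (u • U₀) = gaugeU g (unitsOfRecord U₀)` with `g y = u(siteToLit⁻¹ y)`.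
[cite: Balaban1985BackgroundPropagators, (3.28) p.395] -/
theorem unitsOfRecord_gaugeAct (u : GaugeTransf (F.P K) 0 (SU N)) (U₀ : GaugeField (F.P K) 0 (SU N)) :
    unitsOfRecord F N (gaugeAct u U₀) =
      gaugeU (fun y : TSite (F.P K).d (fun _ => (F.P K).sitesPerDir 0) => suToUnits N (u ((siteToLit (F.P K) 0).symm y))) (unitsOfRecord F N U₀) := by
  funext a
  have hsrc : ((bondToLit (F.P K) 0).symm a).src = (siteToLit (F.P K) 0).symm (bpos a) := by rw [bondToLit_symm_apply]
  have htgt : ((bondToLit (F.P K) 0).symm a).tgt = (siteToLit (F.P K) 0).symm (btgt a) := by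
    rw [Equiv.eq_symm_apply, ← btgt_bondToLit, Equiv.apply_symm_apply]
  rw [gaugeU_apply]
  show suToUnits N (u ((bondToLit (F.P K) 0).symm a).src * U₀ ((bondToLit (F.P K) 0).symm a) * (u ((bondToLit (F.P K) 0).symm a).tgt)⁻¹) =
    suToUnits N (u ((siteToLit (F.P K) 0).symm (bpos a))) * suToUnits N (U₀ ((bondToLit (F.P K) 0).symm a)) *
      (suToUnits N (u ((siteToLit (F.P K) 0).symm (btgt a))))⁻¹
  rw [suToUnits_mul, suToUnits_mul, suToUnits_inv, hsrc, htgt]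

/-- **The flat background is on 35b's guard below every level** (`Ū^j(1) = 1`, whose loop variables sit at `1`; `B15Prop1FlatCoerciveSplit.smallBelow_one_blockAvg` for `SU(N)`).
[cite: Balaban1987RG1, (0.4) p.253, (0.21) p.256] -/
theorem smallBelow_one {P : Params} (k : ℕ) : SmallBelow (fun j => blockAvg (P := P) (j := j) (expMeanLogSU (n := Fin N))) k (1 : GaugeField P 0 (SU N)) := by
  have hiter : ∀ j : ℕ, Averaging.iter (fun j => blockAvg (P := P) (j := j) (expMeanLogSU (n := Fin N))) j (1 : GaugeField P 0 (SU N)) = 1 := by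
    intro j
    induction j with
    | zero => rfl
    | succ j ih =>
      show (blockAvg (P := P) (j := j) expMeanLogSU).avg (Averaging.iter (fun j => blockAvg (P := P) (j := j) expMeanLogSU) j 1) = 1
      rw [ih]
      exact T3DescentFibreTower.avgFun_one _ T3DescentFibreTower.expMeanLogSU_E_one
  intro j _ c
  rw [hiter]
  exact T3DescentFibreTower.small_one _ c

/-! ## §2  Covariance of the record's Hessian, of `Q′♭` and of the projection `R♭(U₀)` -/

section Letters

variable (u : GaugeTransf (F.P K) 0 (SU N)) (U₀ : GaugeField (F.P K) 0 (SU N))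

omit [NeZero N] in
/-- The fibrewise isometry of `R(u(y))` on the record's Hilbert fibre (unitarity of `SU(N)` and `⟨X, Y⟩ = tr X*Y`). [cite: Balaban1985BackgroundPropagators, (3.31) p.395] -/
theorem inner_AdW_suToUnits (g : SU N) (v w : WRec N) : ⟪AdW (phiRec N) (suToUnits N g) v, AdW (phiRec N) (suToUnits N g) w⟫_ℂ = ⟪v, w⟫_ℂ :=
  inner_AdW_AdW_of_compat (phiRec N) (tauRec N) (inner_phiRec_symm (N := N))
    (fun X => tau_AdA_of_trace (tauRec N) (fun X Y => Matrix.trace_mul_comm X Y) _ X) (coe_inv_SU g) v w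

/-- ★ **(3.30) AT THE RECORD**: `Δ₁(u • U₀) R(u) = R(u) Δ₁(U₀)` for def-Y's `hessOpOfRecord` (lit ✓`hessOp_gaugeU` at the record's transporter dictionary §1).
[cite: Balaban1985BackgroundPropagators, (3.30) p.395] -/
theorem hessOpOfRecord_gaugeAct [Fact (0 < c0Rec F K k)] (f : BondL2K ℂ (F.P K).d (fun _ => (F.P K).sitesPerDir 0) (c0Rec F K k) (WRec N)) :
    hessOpOfRecord F N k (gaugeAct u U₀)
        (gaugeW (phiRec N) (fun b : Bond (F.P K).d (fun _ => (F.P K).sitesPerDir 0) => suToUnits N (u ((siteToLit (F.P K) 0).symm (bpos b)))) f) =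
      gaugeW (phiRec N) (fun b : Bond (F.P K).d (fun _ => (F.P K).sitesPerDir 0) => suToUnits N (u ((siteToLit (F.P K) 0).symm (bpos b))))
        (hessOpOfRecord F N k U₀ f) := by
  unfold hessOpOfRecord
  rw [unitsOfRecord_gaugeAct]
  exact hessOp_gaugeU _ (phiRec N) (tauRec N) ((F.P K).eta k)
    (fun y X => tau_AdA_of_trace (tauRec N) (fun X Y => Matrix.trace_mul_comm X Y) _ X) (fun y => coe_inv_SU _) (fun y v w => inner_AdW_suToUnits N _ v w) f

omit [NeZero N] in
/-- **`Q′♭` intertwines the gauge actions**: `Q′♭(R(u)λ)(y) = u(embIter k y) · Q′♭(λ)(y) · u(embIter k y)⋆`. [cite: Balaban1985BackgroundPropagators, (3.32) p.396; Balaban1985Averaging, (11) p.19] -/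
theorem QflatOfRecord_gaugeW (f : SiteL2K ℂ (F.P K).d (fun _ => (F.P K).sitesPerDir 0) (c0Rec F K k) (WRec N)) (y : Site (F.P K) k) :
    QflatOfRecord F N k (gaugeW (phiRec N) (fun z : TSite (F.P K).d (fun _ => (F.P K).sitesPerDir 0) => suToUnits N (u ((siteToLit (F.P K) 0).symm z))) f) y =
      (u (B15DeterminingSets.embIter k y) : Matrix (Fin N) (Fin N) ℂ) * QflatOfRecord F N k f y * star (u (B15DeterminingSets.embIter k y) : Matrix (Fin N) (Fin N) ℂ) := by
  simp only [QflatOfRecord_apply, siteFieldIn_apply, equiv_gaugeW_eq, AdW_apply, Equiv.symm_apply_apply, coe_suToUnits, coe_suToUnits_inv, coe_inv_SU,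
    LinearEquiv.apply_symm_apply]

omit [NeZero N] in
/-- … hence `Q′♭(R(u)λ) = 0 ↔ Q′♭(λ) = 0` (the kernel `N(Q′♭)` is gauge invariant). [cite: Balaban1985BackgroundPropagators, (3.32) p.396] -/
theorem QflatOfRecord_gaugeW_eq_zero_iff (f : SiteL2K ℂ (F.P K).d (fun _ => (F.P K).sitesPerDir 0) (c0Rec F K k) (WRec N)) :
    QflatOfRecord F N k (gaugeW (phiRec N) (fun z : TSite (F.P K).d (fun _ => (F.P K).sitesPerDir 0) => suToUnits N (u ((siteToLit (F.P K) 0).symm z))) f) = 0 ↔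
      QflatOfRecord F N k f = 0 := by
  constructor
  · intro h
    funext y
    have hy := congrFun h y
    rw [QflatOfRecord_gaugeW, Pi.zero_apply] at hy
    have h2 := congrArg (fun M => star (u (B15DeterminingSets.embIter k y) : Matrix (Fin N) (Fin N) ℂ) * M * (u (B15DeterminingSets.embIter k y) : Matrix (Fin N) (Fin N) ℂ)) hy
    simp only [mul_zero, zero_mul] at h2
    rw [Pi.zero_apply, ← h2]
    have hs := star_coe_mul_coe_SU (u (B15DeterminingSets.embIter k y))
    set g : Matrix (Fin N) (Fin N) ℂ := (u (B15DeterminingSets.embIter k y) : Matrix (Fin N) (Fin N) ℂ)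
    calc QflatOfRecord F N k f y = (star g * g) * QflatOfRecord F N k f y * (star g * g) := by rw [hs, one_mul, mul_one]
      _ = star g * (g * QflatOfRecord F N k f y * star g) * g := by noncomm_ring
  · intro h
    funext y
    rw [Pi.zero_apply, QflatOfRecord_gaugeW, congrFun h y, Pi.zero_apply, mul_zero, zero_mul]

/-- ★ **(3.33b) AT THE RECORD**: `R♭(u • U₀) R(u) = R(u) R♭(U₀)` for `RrOfRecord … (QflatOfRecord …)` = the orthogonal projection onto `Δ_{U₀} N(Q′♭)` (lit's
`map_projR_of_intertwine` at the record's covariant Laplacian and `Q′♭`). [cite: Balaban1985BackgroundPropagators, (3.33) p.396, (3.21)-(3.22) p.394] -/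
theorem RrOfRecord_gaugeAct [Fact (0 < c0Rec F K k)] (v : SiteL2K ℂ (F.P K).d (fun _ => (F.P K).sitesPerDir 0) (c0Rec F K k) (WRec N)) :
    RrOfRecord F N k (gaugeAct u U₀) (QflatOfRecord F N k)
        (gaugeW (phiRec N) (fun z : TSite (F.P K).d (fun _ => (F.P K).sitesPerDir 0) => suToUnits N (u ((siteToLit (F.P K) 0).symm z))) v) =
      gaugeW (phiRec N) (fun z : TSite (F.P K).d (fun _ => (F.P K).sitesPerDir 0) => suToUnits N (u ((siteToLit (F.P K) 0).symm z)))
        (RrOfRecord F N k U₀ (QflatOfRecord F N k) v) := by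
  set g : TSite (F.P K).d (fun _ => (F.P K).sitesPerDir 0) → (Matrix (Fin N) (Fin N) ℂ)ˣ := fun z => suToUnits N (u ((siteToLit (F.P K) 0).symm z)) with hg
  have hAd : ∀ (z : TSite (F.P K).d (fun _ => (F.P K).sitesPerDir 0)) (v v' : WRec N), ⟪AdW (phiRec N) (g z) v, AdW (phiRec N) (g z) v'⟫_ℂ = ⟪v, v'⟫_ℂ :=
    fun z v v' => inner_AdW_suToUnits N _ v v'
  have hAd' : ∀ (z : TSite (F.P K).d (fun _ => (F.P K).sitesPerDir 0)) (v v' : WRec N), ⟪AdW (phiRec N) (g⁻¹ z) v, AdW (phiRec N) (g⁻¹ z) v'⟫_ℂ = ⟪v, v'⟫_ℂ :=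
    fun z v v' => by rw [← hAd z (AdW (phiRec N) (g⁻¹ z) v) (AdW (phiRec N) (g⁻¹ z) v'), Pi.inv_apply, B9Eq328GaugeAction.AdW_apply_inv, B9Eq328GaugeAction.AdW_apply_inv]
  -- the covariant Laplacians of the two backgrounds, intertwined by `R(u)`
  have hU : unitsOfRecord F N (gaugeAct u U₀) = gaugeU g (unitsOfRecord F N U₀) := unitsOfRecord_gaugeAct F N u U₀
  have hΔ' : ∀ f : SiteL2K ℂ (F.P K).d (fun _ => (F.P K).sitesPerDir 0) (c0Rec F K k) (WRec N),
      gaugeW (phiRec N) g (covLaplaceSiteK (cRec F K k) (RRec F N U₀) (SRec F N U₀) f) =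
        covLaplaceSiteK (cRec F K k) (RRec F N (gaugeAct u U₀)) (SRec F N (gaugeAct u U₀)) (gaugeW (phiRec N) g f) := by
    intro f
    unfold RRec SRec
    rw [hU]
    exact (covLaplaceSiteK_gaugeU (phiRec N) _ g (unitsOfRecord F N U₀) f).symm
  have hΔ : ∀ a : SiteL2K ℂ (F.P K).d (fun _ => (F.P K).sitesPerDir 0) (c0Rec F K k) (WRec N),
      gaugeW (phiRec N) g⁻¹ (covLaplaceSiteK (cRec F K k) (RRec F N (gaugeAct u U₀)) (SRec F N (gaugeAct u U₀)) a) =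
        covLaplaceSiteK (cRec F K k) (RRec F N U₀) (SRec F N U₀) (gaugeW (phiRec N) g⁻¹ a) := by
    intro a
    have h := hΔ' (gaugeW (phiRec N) g⁻¹ a)
    rw [gaugeW_apply_inv] at h
    rw [← h, gaugeW_inv_apply]
  have hQ' : ∀ f : SiteL2K ℂ (F.P K).d (fun _ => (F.P K).sitesPerDir 0) (c0Rec F K k) (WRec N),
      QflatOfRecord F N k f = 0 → QflatOfRecord F N k (gaugeW (phiRec N) g f) = 0 := fun f hf => (QflatOfRecord_gaugeW_eq_zero_iff F N k u f).2 hf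
  have hQ : ∀ a : SiteL2K ℂ (F.P K).d (fun _ => (F.P K).sitesPerDir 0) (c0Rec F K k) (WRec N),
      QflatOfRecord F N k a = 0 → QflatOfRecord F N k (gaugeW (phiRec N) g⁻¹ a) = 0 := by
    intro a ha
    have hginv : g⁻¹ = fun z => suToUnits N ((fun x => (u x)⁻¹ : GaugeTransf (F.P K) 0 (SU N)) ((siteToLit (F.P K) 0).symm z)) := by
      funext z
      rw [Pi.inv_apply, suToUnits_inv]
    rw [hginv]
    exact (QflatOfRecord_gaugeW_eq_zero_iff F N k (fun x => (u x)⁻¹) a).2 ha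
  have hadj : ∀ (a f : SiteL2K ℂ (F.P K).d (fun _ => (F.P K).sitesPerDir 0) (c0Rec F K k) (WRec N)), ⟪a, gaugeW (phiRec N) g f⟫_ℂ = ⟪gaugeW (phiRec N) g⁻¹ a, f⟫_ℂ := by
    intro a f
    rw [inner_gaugeW_left (phiRec N) g⁻¹ hAd', inv_inv]
  have key := map_projR_of_intertwine (covLaplaceSiteK (c₀ := c0Rec F K k) (cRec F K k) (RRec F N (gaugeAct u U₀)) (SRec F N (gaugeAct u U₀))) (QflatOfRecord F N k)
    (covLaplaceSiteK (c₀ := c0Rec F K k) (cRec F K k) (RRec F N U₀) (SRec F N U₀)) (QflatOfRecord F N k)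
    (gaugeW (phiRec N) g⁻¹) (gaugeW (phiRec N) g) hadj hΔ hΔ' hQ hQ' v
  exact key.symm

/-! ## §3  (3.31)∕(3.32) for the remaining slots and the assembly (3.34) for def-Y's `Δ_{1,a}(U₀)` of record -/

/-- **(3.31a) AT THE RECORD**: `D_{u • U₀} R(u) = R(u) D_{U₀}` for the record's `(3.3)`-derivative (lit ✓`covDerivL2K_gaugeU` read through §1's transporter dictionary).
[cite: Balaban1985BackgroundPropagators, (3.31) p.395, (3.3) p.390] -/
theorem covDerivL2K_RRec_gaugeAct [Fact (0 < c0Rec F K k)] (y : SiteL2K ℂ (F.P K).d (fun _ => (F.P K).sitesPerDir 0) (c0Rec F K k) (WRec N)) :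
    covDerivL2K ℂ (c0Rec F K k) (cRec F K k) (RRec F N (gaugeAct u U₀))
        (gaugeW (phiRec N) (fun z : TSite (F.P K).d (fun _ => (F.P K).sitesPerDir 0) => suToUnits N (u ((siteToLit (F.P K) 0).symm z))) y) =
      gaugeW (phiRec N) (fun b : Bond (F.P K).d (fun _ => (F.P K).sitesPerDir 0) => suToUnits N (u ((siteToLit (F.P K) 0).symm (bpos b))))
        (covDerivL2K ℂ (c0Rec F K k) (cRec F K k) (RRec F N U₀) y) := by
  unfold RRec
  rw [unitsOfRecord_gaugeAct]
  exact covDerivL2K_gaugeU (phiRec N) _ _ _ y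

/-- **(3.31b) AT THE RECORD**: `D*_{u • U₀} R(u) = R(u) D*_{U₀}` for the record's `(3.8)`-divergence (adjoint transporters `SRec`; lit ✓`covDivL2K_gaugeU`).
[cite: Balaban1985BackgroundPropagators, (3.31) p.395, (3.8) p.392] -/
theorem covDivL2K_SRec_gaugeAct [Fact (0 < c0Rec F K k)] (X : BondL2K ℂ (F.P K).d (fun _ => (F.P K).sitesPerDir 0) (c0Rec F K k) (WRec N)) :
    covDivL2K ℂ (c0Rec F K k) (cRec F K k) (SRec F N (gaugeAct u U₀))
        (gaugeW (phiRec N) (fun b : Bond (F.P K).d (fun _ => (F.P K).sitesPerDir 0) => suToUnits N (u ((siteToLit (F.P K) 0).symm (bpos b)))) X) =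
      gaugeW (phiRec N) (fun z : TSite (F.P K).d (fun _ => (F.P K).sitesPerDir 0) => suToUnits N (u ((siteToLit (F.P K) 0).symm z)))
        (covDivL2K ℂ (c0Rec F K k) (cRec F K k) (SRec F N U₀) X) := by
  unfold SRec
  rw [unitsOfRecord_gaugeAct]
  exact covDivL2K_gaugeU (phiRec N) _ _ _ X

/-- **(3.32) AT THE RECORD, lit's bond-source spelling of `R(u)`**: ✓p816707's `QOfRecord_gaugeAct` with the fine gauge function written `b ↦ u(b₋)` through `siteToLit`
(`((bondToLit) ⁻¹ a).src = (siteToLit)⁻¹ (bpos a)`). [cite: Balaban1985BackgroundPropagators, (3.32) p.396] -/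
theorem QOfRecord_gaugeAct_bpos (hk : k ≤ (F.P K).m + (F.P K).K) (h : SmallBelow (avOfRecord F N K) k U₀)
    (x : BondL2K ℂ (F.P K).d (fun _ => (F.P K).sitesPerDir 0) (c0Rec F K k) (WRec N)) :
    QOfRecord F N k (gaugeAct u U₀)
        (gaugeW (phiRec N) (fun b : Bond (F.P K).d (fun _ => (F.P K).sitesPerDir 0) => suToUnits N (u ((siteToLit (F.P K) 0).symm (bpos b)))) x) =
      gaugeW (phiRec N) (fun c : PBond (F.P K) k => suToUnits N (toMS u k c.src)) (QOfRecord F N k U₀ x) := by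
  have hg : (fun b : Bond (F.P K).d (fun _ => (F.P K).sitesPerDir 0) => suToUnits N (u ((siteToLit (F.P K) 0).symm (bpos b)))) =
      fun a : Bond (F.P K).d (fun _ => (F.P K).sitesPerDir 0) => suToUnits N (u ((bondToLit (F.P K) 0).symm a).src) := by
    funext a
    rw [bondToLit_symm_apply]
  rw [hg]
  exact QOfRecord_gaugeAct (F := F) (N := N) (k := k) hk u h x

/-- **THE `Q*`-SLOT IS INTERTWINED**: `Q(u • U₀)† R_k(u) = R(u) Q(U₀)†` — `R(u)` on the fine bond carrier is unitary and onto, `R_k(u)` (by `u_k(c₋)`, [16] (1.15)) is unitary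
on the coarse one (print's *«Q*(U^u)aQ(U^u) = R(u)Q*(U)aQ(U)R(u⁻¹)»*). [cite: Balaban1985BackgroundPropagators, (3.32) pp.395–396] -/
theorem adjoint_QOfRecord_gaugeAct [Fact (0 < c0Rec F K k)] [Fact (∀ c, 0 < wBRec F K k c)] (hk : k ≤ (F.P K).m + (F.P K).K)
    (h : SmallBelow (avOfRecord F N K) k U₀) (y : WL2 ℂ (wBRec F K k) (WRec N)) :
    LinearMap.adjoint (QOfRecord F N k (gaugeAct u U₀)) (gaugeW (phiRec N) (fun c : PBond (F.P K) k => suToUnits N (toMS u k c.src)) y) =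
      gaugeW (phiRec N) (fun b : Bond (F.P K).d (fun _ => (F.P K).sitesPerDir 0) => suToUnits N (u ((siteToLit (F.P K) 0).symm (bpos b))))
        (LinearMap.adjoint (QOfRecord F N k U₀) y) := by
  apply ext_inner_right ℂ
  intro f'
  obtain ⟨f, rfl⟩ : ∃ f, gaugeW (phiRec N) (fun b : Bond (F.P K).d (fun _ => (F.P K).sitesPerDir 0) => suToUnits N (u ((siteToLit (F.P K) 0).symm (bpos b)))) f = f' :=
    ⟨_, gaugeW_apply_inv (phiRec N) _ f'⟩
  rw [LinearMap.adjoint_inner_left, QOfRecord_gaugeAct_bpos F N k u U₀ hk h, inner_gaugeW (phiRec N) _ (fun c v w => inner_AdW_suToUnits N _ v w),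
    inner_gaugeW (phiRec N) _ (fun b v w => inner_AdW_suToUnits N _ v w), LinearMap.adjoint_inner_left]

/-- ★★ **(3.34) FOR def-Y's `Δ_{1,a}(U₀)` OF RECORD**: `Δ_{1,a}(u • U₀) (R(u) f) = R(u) (Δ_{1,a}(U₀) f)` for `laplaceAOfRecord F N k U₀ (QOfRecord F N k U₀) (QflatOfRecord F N k) a`, every
background `U₀` on [Balaban1988RG2] (35b)'s guard up to level `k` and every gauge transformation `u` — assembled from (3.30) `hessOpOfRecord_gaugeAct`, (3.31) `covDerivL2K_RRec_gaugeAct` ∕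
`covDivL2K_SRec_gaugeAct`, (3.33b) `RrOfRecord_gaugeAct` and (3.32) `QOfRecord_gaugeAct_bpos` ∕ `adjoint_QOfRecord_gaugeAct`. [cite: Balaban1985BackgroundPropagators, (3.34) p.396, (3.26) p.395;
Balaban1985Variational, (110) p.294] -/
theorem laplaceAOfRecord_gaugeAct [Fact (0 < c0Rec F K k)] [Fact (∀ c, 0 < wBRec F K k c)] (hk : k ≤ (F.P K).m + (F.P K).K)
    (h : SmallBelow (avOfRecord F N K) k U₀) (a : ℝ) (f : BondL2K ℂ (F.P K).d (fun _ => (F.P K).sitesPerDir 0) (c0Rec F K k) (WRec N)) :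
    laplaceAOfRecord F N k (gaugeAct u U₀) (QOfRecord F N k (gaugeAct u U₀)) (QflatOfRecord F N k) a
        (gaugeW (phiRec N) (fun b : Bond (F.P K).d (fun _ => (F.P K).sitesPerDir 0) => suToUnits N (u ((siteToLit (F.P K) 0).symm (bpos b)))) f) =
      gaugeW (phiRec N) (fun b : Bond (F.P K).d (fun _ => (F.P K).sitesPerDir 0) => suToUnits N (u ((siteToLit (F.P K) 0).symm (bpos b))))
        (laplaceAOfRecord F N k U₀ (QOfRecord F N k U₀) (QflatOfRecord F N k) a f) := by
  have hQs : ∀ s : ℂ, LinearMap.adjoint (QOfRecord F N k (gaugeAct u U₀)) (s • QOfRecord F N k (gaugeAct u U₀)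
      (gaugeW (phiRec N) (fun b : Bond (F.P K).d (fun _ => (F.P K).sitesPerDir 0) => suToUnits N (u ((siteToLit (F.P K) 0).symm (bpos b)))) f)) =
      gaugeW (phiRec N) (fun b : Bond (F.P K).d (fun _ => (F.P K).sitesPerDir 0) => suToUnits N (u ((siteToLit (F.P K) 0).symm (bpos b))))
        (LinearMap.adjoint (QOfRecord F N k U₀) (s • QOfRecord F N k U₀ f)) := fun s => by
    rw [QOfRecord_gaugeAct_bpos F N k u U₀ hk h, ← map_smul, adjoint_QOfRecord_gaugeAct F N k u U₀ hk h]
  unfold laplaceAOfRecord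
  rw [laplaceALatticeK, laplaceALatticeK, laplaceAK_apply, laplaceAK_apply, hessOpOfRecord_gaugeAct, covDivL2K_SRec_gaugeAct, RrOfRecord_gaugeAct,
    covDerivL2K_RRec_gaugeAct, hQs, map_add, map_add]

/-- ★★ **THE QUADRATIC FORM OF `Δ_{1,a}` IS GAUGE INVARIANT AT THE RECORD**: `⟨R(u)f, Δ_{1,a}(u • U₀) R(u)f⟩ = ⟨f, Δ_{1,a}(U₀) f⟩`.
[cite: Balaban1985BackgroundPropagators, (3.34) p.396, p.398 («invariant with respect to gauge transformations of U»)] -/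
theorem inner_laplaceAOfRecord_gaugeAct [Fact (0 < c0Rec F K k)] [Fact (∀ c, 0 < wBRec F K k c)] (hk : k ≤ (F.P K).m + (F.P K).K)
    (h : SmallBelow (avOfRecord F N K) k U₀) (a : ℝ) (f : BondL2K ℂ (F.P K).d (fun _ => (F.P K).sitesPerDir 0) (c0Rec F K k) (WRec N)) :
    ⟪gaugeW (phiRec N) (fun b : Bond (F.P K).d (fun _ => (F.P K).sitesPerDir 0) => suToUnits N (u ((siteToLit (F.P K) 0).symm (bpos b)))) f,
        laplaceAOfRecord F N k (gaugeAct u U₀) (QOfRecord F N k (gaugeAct u U₀)) (QflatOfRecord F N k) a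
          (gaugeW (phiRec N) (fun b : Bond (F.P K).d (fun _ => (F.P K).sitesPerDir 0) => suToUnits N (u ((siteToLit (F.P K) 0).symm (bpos b)))) f)⟫_ℂ =
      ⟪f, laplaceAOfRecord F N k U₀ (QOfRecord F N k U₀) (QflatOfRecord F N k) a f⟫_ℂ := by
  rw [laplaceAOfRecord_gaugeAct F N k u U₀ hk h a f, inner_gaugeW (phiRec N) _ (fun b v w => inner_AdW_suToUnits N _ v w)]

/-! ## §4  [B9] Thm 3.11's displayed positivity `hpos` transfers along gauge orbits; every pure gauge `u • 1` -/

/-- ★★★ **`hpos(U₀) ⟹ hpos(u • U₀)`** for def-Y's handle `frakGOfRecordAtBgFlat` (the displayed hypothesis of ✓`Node00/BgGaugeLetterOfRecord`), `U₀` on the guard up to level `k`.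
[cite: Balaban1985BackgroundPropagators, Thm 3.11 p.416, (3.34) p.396] -/
theorem laplaceAOfRecord_pos_gaugeAct [Fact (0 < c0Rec F K k)] [Fact (∀ c, 0 < wBRec F K k c)] (hk : k ≤ (F.P K).m + (F.P K).K)
    (h : SmallBelow (avOfRecord F N K) k U₀) {a : ℝ}
    (hpos : ∀ x, x ≠ 0 → 0 < RCLike.re ⟪x, laplaceAOfRecord F N k U₀ (QOfRecord F N k U₀) (QflatOfRecord F N k) a x⟫_ℂ)
    (x : BondL2K ℂ (F.P K).d (fun _ => (F.P K).sitesPerDir 0) (c0Rec F K k) (WRec N)) (hx : x ≠ 0) :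
    0 < RCLike.re ⟪x, laplaceAOfRecord F N k (gaugeAct u U₀) (QOfRecord F N k (gaugeAct u U₀)) (QflatOfRecord F N k) a x⟫_ℂ := by
  obtain ⟨y, rfl⟩ : ∃ y, gaugeW (phiRec N) (fun b : Bond (F.P K).d (fun _ => (F.P K).sitesPerDir 0) => suToUnits N (u ((siteToLit (F.P K) 0).symm (bpos b)))) y = x :=
    ⟨_, gaugeW_apply_inv (phiRec N) _ x⟩
  have hy : y ≠ 0 := fun h0 => hx (by rw [h0, map_zero])
  rw [inner_laplaceAOfRecord_gaugeAct F N k u U₀ hk h a y]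
  exact hpos y hy

/-- ★★★ **`hpos(u • U₀) ⟹ hpos(U₀)`** (the same identity read backwards — no inverse gauge transformation needed). [cite: Balaban1985BackgroundPropagators, Thm 3.11 p.416, (3.34) p.396] -/
theorem laplaceAOfRecord_pos_of_pos_gaugeAct [Fact (0 < c0Rec F K k)] [Fact (∀ c, 0 < wBRec F K k c)] (hk : k ≤ (F.P K).m + (F.P K).K)
    (h : SmallBelow (avOfRecord F N K) k U₀) {a : ℝ}
    (hpos' : ∀ x, x ≠ 0 → 0 < RCLike.re ⟪x, laplaceAOfRecord F N k (gaugeAct u U₀) (QOfRecord F N k (gaugeAct u U₀)) (QflatOfRecord F N k) a x⟫_ℂ)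
    (y : BondL2K ℂ (F.P K).d (fun _ => (F.P K).sitesPerDir 0) (c0Rec F K k) (WRec N)) (hy : y ≠ 0) :
    0 < RCLike.re ⟪y, laplaceAOfRecord F N k U₀ (QOfRecord F N k U₀) (QflatOfRecord F N k) a y⟫_ℂ := by
  have hx : gaugeW (phiRec N) (fun b : Bond (F.P K).d (fun _ => (F.P K).sitesPerDir 0) => suToUnits N (u ((siteToLit (F.P K) 0).symm (bpos b)))) y ≠ 0 :=
    fun h0 => hy ((gaugeW_eq_zero_iff (phiRec N) _ y).1 h0)
  rw [← inner_laplaceAOfRecord_gaugeAct F N k u U₀ hk h a y]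
  exact hpos' _ hx

/-- ★★★ **THE DISPLAYED `hpos` IS A PROPERTY OF THE GAUGE ORBIT** (on the guard): `hpos(u • U₀) ↔ hpos(U₀)`. [cite: Balaban1985BackgroundPropagators, Thm 3.11 p.416, (3.34) p.396, p.398] -/
theorem laplaceAOfRecord_pos_gaugeAct_iff [Fact (0 < c0Rec F K k)] [Fact (∀ c, 0 < wBRec F K k c)] (hk : k ≤ (F.P K).m + (F.P K).K)
    (h : SmallBelow (avOfRecord F N K) k U₀) (a : ℝ) :
    (∀ x, x ≠ 0 → 0 < RCLike.re ⟪x, laplaceAOfRecord F N k (gaugeAct u U₀) (QOfRecord F N k (gaugeAct u U₀)) (QflatOfRecord F N k) a x⟫_ℂ) ↔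
      ∀ x, x ≠ 0 → 0 < RCLike.re ⟪x, laplaceAOfRecord F N k U₀ (QOfRecord F N k U₀) (QflatOfRecord F N k) a x⟫_ℂ :=
  ⟨fun h' => laplaceAOfRecord_pos_of_pos_gaugeAct F N k u U₀ hk h h', fun h' => laplaceAOfRecord_pos_gaugeAct F N k u U₀ hk h h'⟩

/-- ★★★ **`Δ_{1,a}` OF RECORD IS POSITIVE DEFINITE AT EVERY PURE-GAUGE BACKGROUND `u • 1`** (`a > 0`, `k ≤ m + K`): def-Y's displayed `hpos` of `frakGOfRecordAtBgFlat` holds on the whole gauge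
orbit of the flat background — ✓p816354 `laplaceAOfRecord_one_flat_pos` (the [B5] (1.69)–(1.72) Hodge argument at `U₀ = 1`) transported by (3.34); the flat background is on the guard at every
level (`smallBelow_one`). [cite: Balaban1985BackgroundPropagators, Thm 3.11 p.416, (3.34) p.396; Balaban1984PropagatorsI, (1.69)–(1.72) pp.29–30; Balaban1985Variational, (110)–(111) p.294] -/
theorem laplaceAOfRecord_pureGauge_pos [Fact (0 < c0Rec F K k)] [Fact (∀ c, 0 < wBRec F K k c)] (hk : k ≤ (F.P K).m + (F.P K).K) {a : ℝ} (ha : 0 < a)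
    (x : BondL2K ℂ (F.P K).d (fun _ => (F.P K).sitesPerDir 0) (c0Rec F K k) (WRec N)) (hx : x ≠ 0) :
    0 < RCLike.re ⟪x, laplaceAOfRecord F N k (gaugeAct u 1) (QOfRecord F N k (gaugeAct u 1)) (QflatOfRecord F N k) a x⟫_ℂ :=
  laplaceAOfRecord_pos_gaugeAct F N k u 1 hk (smallBelow_one N k) (fun y hy => laplaceAOfRecord_one_flat_pos F N k ha y hy) x hx

end Letters

end Summit.QuantumFields.YangMills.Theorems.N07LaplaceAOfRecordGaugeOrbitPos

end
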